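import Mathlib.Analysis.SpecialFunctions.Trigonometric.Basic
import Literature.Topology.FourManifolds.HandleOneModel

/-!
# Helper `helper_handlebodyChart_modelHandles` (M3: handle structure of the model dotted handlebody `D_k`)
# of line `mk_friends` for crux `DcrGap` — handle charts, part 1: the smooth profiles of the tubes
(item stmt-SmoothPoincare4-16128, route route-SmoothPoincare4-DottedCircleRasmussen)

Towards the registered stub `helper_handlebodyChart_modelHandles_data_part1` (the explicit handle charts of
`D_k`).  The planar core of handle tube `j` is, in polar-type coordinates `(r, m)` about the base centre
`z₀` (`r` the distance from `z₀`, `m` the lateral offset at the hole), the curve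
`p₀ ↦ (R(p₀) + b sin(π S(p₀)), -b cos(π S(p₀)))`: two radial legs (`S ∈ {0, 1}`) joined by a half
"ellipse" around the hole (`|p₀| < 1/5`).  This file provides the two smooth profiles and their calculus,
packaged without definitions as the existence statement `ModelHandles.exists_tube_profiles`
(registered summary `helper_handlebodyChart_modelHandles_tubeProfiles`):

* the derivative of `χ = Real.smoothTransition` is `≥ 0`, and `> 0` on `(0, 1)`
  (`ModelHandles.hasDerivAt_smoothTransition`, from `HandleOne.hasDerivAt_expNegInvGlue`);
* the **bend profile** `S(t) = χ((5t + 1)/2)`: `0` for `t ≤ -1/5`, `1` for `t ≥ 1/5`, `S(-t) = 1 - S(t)`,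
  strictly increasing with positive derivative on `(-1/5, 1/5)`;
* the **cutoff** `F(t) = 1 - χ(5t + 5/2)` (`1` for `t ≤ -1/2`, `0` for `t ≥ -3/10`, non-increasing) and the
  **radial profile** `R_V(t) = a(2 + t) F(t) + a(2 - t) F(-t) + (V - t²/10)(1 - F(t) - F(-t))` (`a = 2/15`):
  even, `= a (2 - |t|)` for `|t| ≥ 1/2`, `= V - t²/10` for `|t| ≤ 3/10`, with positive derivative on `(-2, 0)`
  (`V ≥ 1`), hence strictly increasing on `[-2, 0]`;
* the Jacobian sign `R' cos(π S) + b π S' > 0` on `(-2, 2)` for every `b > 0`.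

No definitions, no named facts, no `sorry`.  References: R. Kirby, *The Topology of 4-Manifolds*,
LNM 1374 (1989), Ch. I §2 [Kirby1989] (the handle picture being charted).
-/

-- the prescribed namespace `Summit.<P>.<Sub>.…` duplicates `SmoothPoincare4` (P = Sub)
set_option linter.dupNamespace false
set_option linter.style.longLine false
noncomputable section

open Set Filter
open scoped Topology ContDiff
open Literature.Topology.FourManifolds

namespace Summit.SmoothPoincare4.SmoothPoincare4.Theorems.DcrGap.MkFriends

namespace ModelHandles

/-! ## The derivative of the smooth transition -/

/-- **The smooth transition has a non-negative derivative, positive on `(0, 1)`.** [folklore] -/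
theorem hasDerivAt_smoothTransition (x : ℝ) : ∃ D : ℝ, HasDerivAt Real.smoothTransition D x ∧ 0 ≤ D ∧
    (0 < x → x < 1 → 0 < D) := by
  have hf := HandleOne.hasDerivAt_expNegInvGlue x
  have hg : HasDerivAt (fun y => expNegInvGlue (1 - y)) (-((1 - x)⁻¹ ^ 2 * expNegInvGlue (1 - x))) x := by
    have h1 : HasDerivAt (fun y : ℝ => 1 - y) (-1) x := by
      simpa using (hasDerivAt_id x).const_sub 1
    have h := (HandleOne.hasDerivAt_expNegInvGlue (1 - x)).comp x h1
    exact h.congr_deriv (by ring)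
  have hpos := Real.smoothTransition.pos_denom x
  have hq := hf.div (hf.add hg) hpos.ne'
  refine ⟨(x⁻¹ ^ 2 * expNegInvGlue x * expNegInvGlue (1 - x) +
    expNegInvGlue x * ((1 - x)⁻¹ ^ 2 * expNegInvGlue (1 - x))) / (expNegInvGlue x + expNegInvGlue (1 - x)) ^ 2,
    hq.congr_deriv ?_, ?_, fun h0 h1' => ?_⟩
  · simp only [Pi.add_apply]
    congr 1
    ring
  · have h1 := expNegInvGlue.nonneg x
    have h2 := expNegInvGlue.nonneg (1 - x)
    exact div_nonneg (add_nonneg (mul_nonneg (mul_nonneg (sq_nonneg _) h1) h2)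
      (mul_nonneg h1 (mul_nonneg (sq_nonneg _) h2))) (sq_nonneg _)
  · have h1 := expNegInvGlue.pos_of_pos h0
    have h2 := expNegInvGlue.pos_of_pos (sub_pos.2 h1')
    have hx : 0 < x⁻¹ ^ 2 := pow_pos (inv_pos.2 h0) 2
    exact div_pos (add_pos_of_pos_of_nonneg (mul_pos (mul_pos hx h1) h2)
      (mul_nonneg h1.le (mul_nonneg (sq_nonneg _) h2.le))) (pow_pos hpos 2)

/-- The derivative of an affine reparametrisation `t ↦ χ(u t + v)` of the smooth transition: `≥ 0`
(`u > 0`), and `> 0` where `0 < u t + v < 1`. [folklore] -/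
theorem hasDerivAt_smoothTransition_affine (u v t : ℝ) (hu : 0 < u) :
    ∃ D : ℝ, HasDerivAt (fun s => Real.smoothTransition (u * s + v)) D t ∧ 0 ≤ D ∧
      (0 < u * t + v → u * t + v < 1 → 0 < D) := by
  obtain ⟨D, hD, hD0, hDpos⟩ := hasDerivAt_smoothTransition (u * t + v)
  have hlin : HasDerivAt (fun s : ℝ => u * s + v) u t := by
    have h := ((hasDerivAt_id t).const_mul u).add_const v
    exact h.congr_deriv (by simp)
  have h2 := hD.comp t hlin
  refine ⟨D * u, h2, by positivity, fun h1 h2 => ?_⟩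
  have := hDpos h1 h2
  positivity

/-! ## The bend profile `S(t) = χ((5t + 1)/2)` -/

/-- **The bend profile** `S(t) = χ((5t + 1)/2)`: smooth, `0` up to `-1/5`, `1` from `1/5` on, values in
`[0, 1]`, `S(-t) = 1 - S(t)`, strictly increasing on `[-1/5, 1/5]`, with a non-negative derivative which is
positive on `(-1/5, 1/5)`. [folklore] -/
theorem profS_props (S : ℝ → ℝ) (hS : S = fun t => Real.smoothTransition ((5 * t + 1) / 2)) :
    ContDiff ℝ ∞ S ∧ (∀ t, t ≤ -1 / 5 → S t = 0) ∧ (∀ t, 1 / 5 ≤ t → S t = 1) ∧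
    (∀ t, 0 ≤ S t ∧ S t ≤ 1) ∧ (∀ t, S (-t) = 1 - S t) ∧ StrictMonoOn S (Icc (-1 / 5) (1 / 5)) ∧
    (∀ t, ∃ D : ℝ, HasDerivAt S D t ∧ 0 ≤ D ∧ (-1 / 5 < t → t < 1 / 5 → 0 < D)) := by
  have hS' : S = fun t => Real.smoothTransition (5 / 2 * t + 1 / 2) := by
    rw [hS]; funext t; congr 1; ring
  have hder : ∀ t, ∃ D : ℝ, HasDerivAt S D t ∧ 0 ≤ D ∧ (-1 / 5 < t → t < 1 / 5 → 0 < D) := by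
    intro t
    obtain ⟨D, hD, hD0, hpos⟩ := hasDerivAt_smoothTransition_affine (5 / 2) (1 / 2) t (by norm_num)
    rw [hS']
    exact ⟨D, hD, hD0, fun h1 h2 => hpos (by linarith) (by linarith)⟩
  subst hS
  refine ⟨?_, fun t ht => ?_, fun t ht => ?_, fun t => ?_, fun t => ?_, ?_, hder⟩
  · exact Real.smoothTransition.contDiff.comp (((contDiff_const.mul contDiff_id).add contDiff_const).div_const _)
  · exact Real.smoothTransition.zero_of_nonpos (by linarith)
  · exact Real.smoothTransition.one_of_one_le (by linarith)
  · exact ⟨Real.smoothTransition.nonneg _, Real.smoothTransition.le_one _⟩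
  · -- the symmetry `χ(1 - x) = 1 - χ(x)`
    have hpos := Real.smoothTransition.pos_denom ((5 * t + 1) / 2)
    have h1 : (5 * -t + 1) / 2 = 1 - (5 * t + 1) / 2 := by ring
    simp only [h1, Real.smoothTransition, sub_sub_cancel]
    rw [add_comm (expNegInvGlue (1 - (5 * t + 1) / 2)), eq_sub_iff_add_eq, ← add_div, add_comm,
      div_self hpos.ne']
  · refine strictMonoOn_of_deriv_pos (convex_Icc _ _)
      (Real.smoothTransition.continuous.comp (by fun_prop)).continuousOn fun t ht => ?_
    rw [interior_Icc] at ht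
    obtain ⟨D, hD, -, hpos⟩ := hder t
    rw [hD.deriv]
    exact hpos ht.1 ht.2

/-- Consequences for the bend profile: `S(0) = 1/2`, and `S < 1/2`, `S = 1/2`, `1/2 < S` exactly on
`t < 0`, `t = 0`, `0 < t`. [folklore] -/
theorem profS_half {S : ℝ → ℝ} (h0 : ∀ t, t ≤ -1 / 5 → S t = 0) (hsymm : ∀ t, S (-t) = 1 - S t)
    (hmono : StrictMonoOn S (Icc (-1 / 5) (1 / 5))) :
    S 0 = 1 / 2 ∧ (∀ t, S t < 1 / 2 ↔ t < 0) ∧ (∀ t, 1 / 2 < S t ↔ 0 < t) ∧ (∀ t, S t = 1 / 2 ↔ t = 0) := by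
  have hS0 : S 0 = 1 / 2 := by have h := hsymm 0; rw [neg_zero] at h; linarith
  have h1 : ∀ t, 1 / 5 ≤ t → S t = 1 := fun t ht => by
    have h := hsymm t; rw [h0 (-t) (by linarith)] at h; linarith
  have hmono' : Monotone S := by
    intro s t hst
    rcases le_or_gt s (-1 / 5) with hs | hs
    · rw [h0 s hs]
      rcases le_or_gt t (-1 / 5) with ht | ht
      · rw [h0 t ht]
      · rcases le_or_gt t (1 / 5) with ht' | ht'
        · have := hmono.monotoneOn ⟨le_rfl, by norm_num⟩ ⟨ht.le, ht'⟩ ht.le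
          rwa [h0 _ le_rfl] at this
        · rw [h1 t ht'.le]; norm_num
    · rcases le_or_gt t (1 / 5) with ht' | ht'
      · exact hmono.monotoneOn ⟨hs.le, by linarith⟩ ⟨by linarith, ht'⟩ hst
      · rw [h1 t ht'.le]
        rcases le_or_gt s (1 / 5) with hs' | hs'
        · have := hmono.monotoneOn ⟨hs.le, hs'⟩ ⟨by norm_num, le_rfl⟩ hs'
          rwa [h1 _ le_rfl] at this
        · rw [h1 s hs'.le]
  have hlt : ∀ t, S t < 1 / 2 ↔ t < 0 := by
    intro t
    constructor
    · intro h
      by_contra ht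
      push Not at ht
      have := hmono' ht
      rw [hS0] at this
      linarith
    · intro ht
      rcases lt_or_ge t (-1 / 5) with h2 | h2
      · rw [h0 t h2.le]; norm_num
      · have := hmono ⟨h2, by linarith⟩ ⟨by norm_num, by norm_num⟩ ht
        rwa [hS0] at this
  have hgt : ∀ t, 1 / 2 < S t ↔ 0 < t := by
    intro t
    have h := hlt (-t)
    rw [hsymm] at h
    constructor
    · intro h2; have := h.1 (by linarith); linarith
    · intro h2; have := h.2 (by linarith); linarith
  refine ⟨hS0, hlt, hgt, fun t => ⟨fun h => ?_, fun h => by rw [h, hS0]⟩⟩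
  rcases lt_trichotomy t 0 with ht | ht | ht
  · have := (hlt t).2 ht; linarith
  · exact ht
  · have := (hgt t).2 ht; linarith

/-! ## The cutoff `F(t) = 1 - χ(5t + 5/2)` and the radial profile -/

/-- **The cutoff** `F(t) = 1 - χ(5t + 5/2)`: smooth, `1` up to `-1/2`, `0` from `-3/10` on, values in
`[0, 1]`, positive before `-3/10`, with non-positive derivative. [folklore] -/
theorem cutF_props (F : ℝ → ℝ) (hF : F = fun t => 1 - Real.smoothTransition (5 * t + 5 / 2)) :
    ContDiff ℝ ∞ F ∧ (∀ t, t ≤ -1 / 2 → F t = 1) ∧ (∀ t, -3 / 10 ≤ t → F t = 0) ∧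
    (∀ t, 0 ≤ F t ∧ F t ≤ 1) ∧ (∀ t, t < -3 / 10 → 0 < F t) ∧
    (∀ t, ∃ D : ℝ, HasDerivAt F D t ∧ D ≤ 0) := by
  subst hF
  refine ⟨?_, fun t ht => ?_, fun t ht => ?_, fun t => ?_, fun t ht => ?_, fun t => ?_⟩
  · exact contDiff_const.sub (Real.smoothTransition.contDiff.comp
      ((contDiff_const.mul contDiff_id).add contDiff_const))
  · simp only [Real.smoothTransition.zero_of_nonpos (show 5 * t + 5 / 2 ≤ 0 by linarith), sub_zero]
  · simp only [Real.smoothTransition.one_of_one_le (show 1 ≤ 5 * t + 5 / 2 by linarith), sub_self]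
  · exact ⟨by linarith [Real.smoothTransition.le_one (5 * t + 5 / 2)],
      by linarith [Real.smoothTransition.nonneg (5 * t + 5 / 2)]⟩
  · linarith [Real.smoothTransition.lt_one_of_lt_one (x := 5 * t + 5 / 2) (by linarith)]
  · obtain ⟨D, hD, hD0, -⟩ := hasDerivAt_smoothTransition_affine 5 (5 / 2) t (by norm_num)
    exact ⟨-D, hD.const_sub 1, by linarith⟩

/-- **The radial profile** `R_V(t) = a(2 + t) F(t) + a(2 - t) F(-t) + (V - t²/10)(1 - F(t) - F(-t))`
(`a = 2/15`, `V ≥ 1`): smooth, even, `= a(2 - |t|)` for `|t| ≥ 1/2`, `= V - t²/10` for `|t| ≤ 3/10`,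
between `a(2 + t)` and `V` on `[-2, 0]`, with positive derivative on `(-2, 0)` (so strictly increasing
on `[-2, 0]`), negative derivative on `(0, 2)` and derivative `0` at `0`. [folklore] -/
theorem profR_props (V : ℝ) (hV : 1 ≤ V) (F R : ℝ → ℝ)
    (hF : F = fun t => 1 - Real.smoothTransition (5 * t + 5 / 2))
    (hR : R = fun t => 2 / 15 * (2 + t) * F t + 2 / 15 * (2 - t) * F (-t) + (V - t ^ 2 / 10) * (1 - F t - F (-t))) :
    ContDiff ℝ ∞ R ∧ (∀ t, R (-t) = R t) ∧ (∀ t, 1 / 2 ≤ |t| → R t = 2 / 15 * (2 - |t|)) ∧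
    (∀ t, |t| ≤ 3 / 10 → R t = V - t ^ 2 / 10) ∧
    (∀ t, -2 ≤ t → t ≤ 0 → 2 / 15 * (2 + t) ≤ R t ∧ R t ≤ V) ∧
    (∀ t, -2 < t → t < 0 → ∃ D : ℝ, HasDerivAt R D t ∧ 0 < D) ∧
    (∀ t, 0 < t → t < 2 → ∃ D : ℝ, HasDerivAt R D t ∧ D < 0) ∧ HasDerivAt R 0 0 ∧
    StrictMonoOn R (Icc (-2) 0) := by
  obtain ⟨hFs, hF1, hF0, hF01, hFpos, hFder⟩ := cutF_props F hF
  have hReven : ∀ t, R (-t) = R t := fun t => by rw [hR]; simp only [neg_neg]; ring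
  -- on `t ≤ 3/10` the second cutoff vanishes
  have hRle3 : ∀ t, t ≤ 3 / 10 → R t = V - t ^ 2 / 10 - (V - t ^ 2 / 10 - 2 / 15 * (2 + t)) * F t := by
    intro t ht; rw [hR]; simp only [hF0 (-t) (by linarith)]; ring
  have hRmid : ∀ t, |t| ≤ 3 / 10 → R t = V - t ^ 2 / 10 := fun t ht => by
    rw [abs_le] at ht; rw [hRle3 t ht.2, hF0 t (by linarith)]; ring
  have hRder : ∀ t, -2 < t → t < 0 → ∃ D : ℝ, HasDerivAt R D t ∧ 0 < D := by
    intro t h1 h2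
    obtain ⟨F', hF', hF'0⟩ := hFder t
    have heq : R =ᶠ[𝓝 t] fun s => V - s ^ 2 / 10 - (V - s ^ 2 / 10 - 2 / 15 * (2 + s)) * F s := by
      filter_upwards [Iio_mem_nhds (show t < 3 / 10 by linarith)] with s hs
      exact hRle3 s hs.le
    have hsq : HasDerivAt (fun s : ℝ => V - s ^ 2 / 10) (-(2 * t / 10)) t := by
      have h := (((hasDerivAt_id t).pow 2).div_const 10).const_sub V
      exact h.congr_deriv (by simp)
    have hG : HasDerivAt (fun s : ℝ => V - s ^ 2 / 10 - 2 / 15 * (2 + s)) (-(2 * t / 10) - 2 / 15) t := by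
      have h := hsq.sub (((hasDerivAt_id t).const_add 2).const_mul (2 / 15 : ℝ))
      exact h.congr_deriv (by simp)
    have hmain : HasDerivAt (fun s => V - s ^ 2 / 10 - (V - s ^ 2 / 10 - 2 / 15 * (2 + s)) * F s)
        (-(2 * t / 10) - ((-(2 * t / 10) - 2 / 15) * F t + (V - t ^ 2 / 10 - 2 / 15 * (2 + t)) * F')) t :=
      hsq.sub (hG.mul hF')
    refine ⟨_, hmain.congr_of_eventuallyEq heq, ?_⟩
    obtain ⟨hFt0, hFt1⟩ := hF01 t
    have hGpos : 0 < V - t ^ 2 / 10 - 2 / 15 * (2 + t) := by nlinarith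
    have hprod : (V - t ^ 2 / 10 - 2 / 15 * (2 + t)) * F' ≤ 0 := mul_nonpos_of_nonneg_of_nonpos hGpos.le hF'0
    rcases lt_or_ge t (-3 / 10) with ht | ht
    · have := hFpos t ht
      nlinarith
    · rw [hF0 t ht]
      nlinarith
  have hRs : ContDiff ℝ ∞ R := by
    rw [hR]
    have hFn : ContDiff ℝ ∞ fun t => F (-t) := hFs.comp contDiff_neg
    fun_prop
  have hmono : StrictMonoOn R (Icc (-2) 0) := by
    refine strictMonoOn_of_deriv_pos (convex_Icc _ _) hRs.continuous.continuousOn fun t ht => ?_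
    rw [interior_Icc] at ht
    obtain ⟨D, hD, hpos⟩ := hRder t ht.1 ht.2
    rwa [hD.deriv]
  refine ⟨hRs, hReven, fun t ht => ?_, hRmid, fun t h1 h2 => ?_, hRder, fun t h1 h2 => ?_, ?_, hmono⟩
  · -- `|t| ≥ 1/2`
    have key : ∀ s, s ≤ -1 / 2 → R s = 2 / 15 * (2 + s) := fun s hs => by
      rw [hRle3 s (by linarith), hF1 s hs]; ring
    rcases le_or_gt 0 t with h | h
    · rw [abs_of_nonneg h] at ht ⊢
      rw [← hReven, key (-t) (by linarith)]; ring
    · rw [abs_of_neg h] at ht ⊢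
      rw [key t (by linarith)]; ring
  · rw [hRle3 t (by linarith)]
    obtain ⟨hFt0, hFt1⟩ := hF01 t
    have ht2 : t ^ 2 ≤ 4 := by nlinarith
    constructor <;> nlinarith
  · obtain ⟨D, hD, hpos⟩ := hRder (-t) (by linarith) (by linarith)
    have h := hD.comp t (hasDerivAt_neg t)
    have heq : (R ∘ Neg.neg) = R := funext fun s => hReven s
    rw [heq] at h
    exact ⟨D * -1, h, by linarith⟩
  · have heq : R =ᶠ[𝓝 0] fun s => V - s ^ 2 / 10 := by
      filter_upwards [Ioo_mem_nhds (show -(3 : ℝ) / 10 < 0 by norm_num) (show (0 : ℝ) < 3 / 10 by norm_num)]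
        with s hs
      exact hRmid s (abs_le.2 ⟨by linarith [hs.1], hs.2.le⟩)
    have h : HasDerivAt (fun s : ℝ => V - s ^ 2 / 10) 0 0 := by
      have h := (((hasDerivAt_id (0 : ℝ)).pow 2).div_const 10).const_sub V
      exact h.congr_deriv (by simp)
    exact h.congr_of_eventuallyEq heq

/-! ## The Jacobian sign and the packaged profiles -/

/-- **The Jacobian sign**: for profiles `R`, `S` as above and every `b > 0`,
`R'(t) cos(π S(t)) + b π S'(t) > 0` on `(-2, 2)` — on the legs `R' cos(π S) > 0`, on the bend `S' > 0`,
and the two terms never have opposite signs. [folklore] -/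
theorem jacobian_sign {R S : ℝ → ℝ}
    (hS0 : ∀ t, t ≤ -1 / 5 → S t = 0) (hS1 : ∀ t, 1 / 5 ≤ t → S t = 1) (hS01 : ∀ t, 0 ≤ S t ∧ S t ≤ 1)
    (hSsymm : ∀ t, S (-t) = 1 - S t) (hSmono : StrictMonoOn S (Icc (-1 / 5) (1 / 5)))
    (hSder : ∀ t, ∃ D : ℝ, HasDerivAt S D t ∧ 0 ≤ D ∧ (-1 / 5 < t → t < 1 / 5 → 0 < D))
    (hRpos : ∀ t, -2 < t → t < 0 → ∃ D : ℝ, HasDerivAt R D t ∧ 0 < D)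
    (hRneg : ∀ t, 0 < t → t < 2 → ∃ D : ℝ, HasDerivAt R D t ∧ D < 0) (hR0 : HasDerivAt R 0 0)
    (t b : ℝ) (h1 : -2 < t) (h2 : t < 2) (hb : 0 < b) :
    ∃ R' S' : ℝ, HasDerivAt R R' t ∧ HasDerivAt S S' t ∧ 0 < R' * Real.cos (Real.pi * S t) + b * Real.pi * S' := by
  obtain ⟨-, hlt, hgt, -⟩ := profS_half hS0 hSsymm hSmono
  obtain ⟨S', hS', hS'0, hS'pos⟩ := hSder t
  have hπ := Real.pi_pos
  rcases lt_trichotomy t 0 with ht | rfl | ht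
  · obtain ⟨R', hR', hR'pos⟩ := hRpos t h1 ht
    refine ⟨R', S', hR', hS', ?_⟩
    have hcos : 0 ≤ Real.cos (Real.pi * S t) := by
      have hs := (hlt t).2 ht
      apply Real.cos_nonneg_of_neg_pi_div_two_le_of_le <;> nlinarith [(hS01 t).1]
    have hbS : 0 ≤ b * Real.pi * S' := mul_nonneg (mul_pos hb hπ).le hS'0
    rcases le_or_gt t (-1 / 5) with ht' | ht'
    · rw [hS0 t ht', mul_zero, Real.cos_zero, mul_one]
      linarith
    · have h3 := mul_pos (mul_pos hb hπ) (hS'pos ht' (by linarith))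
      linarith [mul_nonneg hR'pos.le hcos]
  · refine ⟨0, S', hR0, hS', ?_⟩
    have h3 := mul_pos (mul_pos hb hπ) (hS'pos (by norm_num) (by norm_num))
    linarith
  · obtain ⟨R', hR', hR'neg⟩ := hRneg t ht h2
    refine ⟨R', S', hR', hS', ?_⟩
    have hcos : Real.cos (Real.pi * S t) ≤ 0 := by
      have hs := (hgt t).2 ht
      apply Real.cos_nonpos_of_pi_div_two_le_of_le <;> nlinarith [(hS01 t).2]
    have hbS : 0 ≤ b * Real.pi * S' := mul_nonneg (mul_pos hb hπ).le hS'0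
    rcases lt_or_ge t (1 / 5) with ht' | ht'
    · have h3 := mul_pos (mul_pos hb hπ) (hS'pos (by linarith) ht')
      linarith [mul_nonneg_of_nonpos_of_nonpos hR'neg.le hcos]
    · rw [hS1 t ht', mul_one, Real.cos_pi]
      linarith

/-- **The tube profiles exist** (`V ≥ 1`): smooth `R`, `S : ℝ → ℝ` with `R` even, `S(-t) = 1 - S(t)`,
`R = a(2 - |t|)` for `|t| ≥ 1/2`, `V - 1/250 ≤ R ≤ V` on `|t| ≤ 1/5`, `a(2 + t) ≤ R ≤ V` and `R` strictly
increasing on `[-2, 0]`, `S = 0` before `-1/5`, `S = 1` after `1/5`, `S` strictly increasing on `[-1/5, 1/5]`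
with values in `[0, 1]`, and the Jacobian sign `R' cos(π S) + b π S' > 0` on `(-2, 2)` for all `b > 0`.
[folklore] -/
theorem exists_tube_profiles (V : ℝ) (hV : 1 ≤ V) : ∃ R S : ℝ → ℝ,
    ContDiff ℝ ∞ R ∧ ContDiff ℝ ∞ S ∧ (∀ t, R (-t) = R t) ∧ (∀ t, S (-t) = 1 - S t) ∧
    (∀ t, 1 / 2 ≤ |t| → R t = 2 / 15 * (2 - |t|)) ∧
    (∀ t, |t| ≤ 1 / 5 → V - 1 / 250 ≤ R t ∧ R t ≤ V) ∧
    (∀ t, -2 ≤ t → t ≤ 0 → 2 / 15 * (2 + t) ≤ R t ∧ R t ≤ V) ∧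
    StrictMonoOn R (Icc (-2) 0) ∧
    (∀ t, t ≤ -1 / 5 → S t = 0) ∧ (∀ t, 1 / 5 ≤ t → S t = 1) ∧
    StrictMonoOn S (Icc (-1 / 5) (1 / 5)) ∧ (∀ t, 0 ≤ S t ∧ S t ≤ 1) ∧
    (∀ t b, -2 < t → t < 2 → 0 < b → ∃ R' S' : ℝ, HasDerivAt R R' t ∧ HasDerivAt S S' t ∧
      0 < R' * Real.cos (Real.pi * S t) + b * Real.pi * S') := by
  set F : ℝ → ℝ := fun t => 1 - Real.smoothTransition (5 * t + 5 / 2) with hF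
  set R : ℝ → ℝ := fun t => 2 / 15 * (2 + t) * F t + 2 / 15 * (2 - t) * F (-t) +
    (V - t ^ 2 / 10) * (1 - F t - F (-t)) with hR
  set S : ℝ → ℝ := fun t => Real.smoothTransition ((5 * t + 1) / 2) with hS
  obtain ⟨hSs, hS0, hS1, hS01, hSsymm, hSmono, hSder⟩ := profS_props S hS
  obtain ⟨hRs, hReven, hRout, hRmid, hRbounds, hRpos, hRneg, hR0, hRmono⟩ := profR_props V hV F R hF hR
  refine ⟨R, S, hRs, hSs, hReven, hSsymm, hRout, fun t ht => ?_, hRbounds, hRmono, hS0, hS1, hSmono, hS01,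
    fun t b h1 h2 hb => jacobian_sign hS0 hS1 hS01 hSsymm hSmono hSder hRpos hRneg hR0 t b h1 h2 hb⟩
  rw [hRmid t (by linarith [ht])]
  have := abs_le.1 ht
  constructor <;> nlinarith

end ModelHandles

/-- **Registered piece `helper_handlebodyChart_modelHandles_tubeProfiles` of the data stub, part 1 (the smooth
profiles of the handle tubes)**: for `V ≥ 1` there are smooth profiles `R` (radial, even, `a(2 - |t|)` near the
ends, `≈ V` on the bend, strictly increasing on `[-2, 0]`) and `S` (bend, a smooth step from `0` to `1` on
`[-1/5, 1/5]` with `S(-t) = 1 - S(t)`) with the Jacobian sign `R' cos(π S) + b π S' > 0`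
(`ModelHandles.exists_tube_profiles`). [folklore] -/
theorem helper_handlebodyChart_modelHandles_tubeProfiles : ∀ (V : ℝ), 1 ≤ V → ∃ R S : ℝ → ℝ, ContDiff ℝ ((⊤ : ℕ∞) : WithTop ℕ∞) R ∧ ContDiff ℝ ((⊤ : ℕ∞) : WithTop ℕ∞) S ∧ (∀ t, R (-t) = R t) ∧ (∀ t, S (-t) = 1 - S t) ∧ (∀ t, 1 / 2 ≤ |t| → R t = 2 / 15 * (2 - |t|)) ∧ (∀ t, |t| ≤ 1 / 5 → V - 1 / 250 ≤ R t ∧ R t ≤ V) ∧ (∀ t, -2 ≤ t → t ≤ 0 → 2 / 15 * (2 + t) ≤ R t ∧ R t ≤ V) ∧ StrictMonoOn R (Set.Icc (-2) 0) ∧ (∀ t, t ≤ -1 / 5 → S t = 0) ∧ (∀ t, 1 / 5 ≤ t → S t = 1) ∧ StrictMonoOn S (Set.Icc (-1 / 5) (1 / 5)) ∧ (∀ t, 0 ≤ S t ∧ S t ≤ 1) ∧ (∀ t b, -2 < t → t < 2 → 0 < b → ∃ R' S' : ℝ, HasDerivAt R R' t ∧ HasDerivAt S S' t ∧ 0 <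 R' * Real.cos (Real.pi * S t) + b * Real.pi * S') :=
  fun V hV => ModelHandles.exists_tube_profiles V hV

end Summit.SmoothPoincare4.SmoothPoincare4.Theorems.DcrGap.MkFriends

end
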